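import Literature.MathematicalPhysics.QuantumFieldTheory.Balaban1983to89.Beta.RemainderChainKP
import Literature.MathematicalPhysics.QuantumFieldTheory.Balaban1983to89.B13Closing
import Literature.MathematicalPhysics.QuantumFieldTheory.Balaban1983to89.B12Decay510Lattice

/-!
# `Balaban1983to89.Beta.RemainderChainLattice` — the remainder chain (2.38) ⟹ (I.1.18) ⟹ (5.10) ⟹ (1.22) ON THE
CONCRETE CARRIER the tree has (windows of cubes of side M of ℤ^d, localization domains = non-empty face-connected
families of cubes, d_j := tree length, sites = lattice points): EVERY GEOMETRIC LEAF of `Beta.RemainderChainKP.PolLeavesKP`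
(the polymer `Geometry` of 𝐃_{k+1}, the site geometry, (4.37)/(0.26) `hgeo`, the cube sum `hcube`, the tree sum `htree`,
the metric leaf `hρ`) is CONSTRUCTED / PROVED by name from landed modules, so that the k-uniform remainder coefficient
becomes a CLOSED FORMULA `K_rem,L(d, M, c, α₂, B₃)` in the printed analytic constants — no abstract c₁, K₀, K₁, ν, κ₀ left —
and the numeric restrictions become FOUR explicit k-free, volume-free numbers (β sub-cell row BETA-an4 = the k-uniform
remainder, unit `b2b-balaban-beta-an4` gen 7; bookkeeping BY NAME over `Beta.RemainderChainKP` (an4 gen 6, GAPS C-an4-14),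
`B13Closing` (b13-g3, GAPS C-B13-11), `B12Decay510Lattice` (b03-g4, GAPS C-b03g4-3 / XREAD C-pv14-25), `B12Decay510Window`
(b03-g3, C-b03g3-2), `TreeLengthCubeSystem` (pv22, C-pv22-4), `Beta.RemainderChain`, `Beta.DriftRemainder`).

HONEST FRAMING (cell `pub-balaban`, BETA-SPEC, verbatim): discharging `BetaPertH` makes Bałaban's UV stability
UNCONDITIONAL — a real constructive-QFT result; it is NOT the continuum limit and NOT the Clay problem.  (Gloss 1,
BETA-SPEC v1.8d/v1.9b l. 17–18, GAPS G-ref2-14 (a) / G-ref2-20 (a), verbatim: «UNCONDITIONAL» in [Balaban1989LargeFieldII]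
(B16) p. 355's interval-hypothesis sense ONLY (`FlowStepRuns.p355Unconditional_of_partialSums` keeps `hnodes`); the located
leaves G-adv3-2 (left inequality of (0.1)/(2.50), d = 4), G-adv3-1 (U2 transfer of B14 Cor. 3's lower bound) and
`SecondExpLeaf` REMAIN.  Gloss 2, BETA-SPEC v1.9e, beta-ref C-beta-78, BINDING: «unconditional» =
`Beta.Assembly.EventualForm`-unconditional END statement, NOT «Theorem 2 as printed».  Gloss 3″ (BETA-SPEC v1.9r §7.20,
reading, not a new claim): on the primary (composed) road of RULING (R10) «unconditional» = the END statement
`B12.EndpointExistence C` / `FlowStepRuns.BetaPartialSumsLowerH`-unconditional modulo the binders listed there by name;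
never «Theorem 2 as printed», never continuum / mass gap / Clay.)  THIS MODULE DISCHARGES NOTHING of Lemma 3, of the
representation (2.13), of the restriction property of the spaces, of the [I] (4.4) seam or of the [I] §§4–5 ANALYTIC
leaves ((4.4)-analyticity, (4.35), the p. 282 minimizer decay, the limit (5.1)): every theorem is a composition BY NAME of
landed, imported-untouched modules or `[folklore]` real arithmetic; nothing about Bałaban's β-functions (1.22) is
asserted.  Value = the row's constant table kernel-valued on the one concrete geometry the tree has (audit cell
`pub-balaban`, β sub-cell), NOT summit progress.

ABSOLUTE RULE (cell, verbatim): no internally-minted statement may enter as a cited fact; every hypothesis is either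
kernel-proved in this package or a verbatim quotation of a PUBLISHED theorem with page reference; the manuscripts under
audit are NOT citable for their own disputed steps.  Nothing below is cited as a fact; the `[cite: …]` tags on theorems
point at the printed display a theorem's conclusion has the SHAPE of, or at the printed CONTEXT of a hypothesis binder,
exactly as in `Beta.RemainderChain` / `Beta.RemainderChainKP` / `B13Closing` / `B12Decay510Lattice`.

CITATION HEADER (lean-in-tree rule).  [II] = T. Bałaban, *Renormalization group approach to lattice gauge field
theories. II. Cluster expansions*, Commun. Math. Phys. **116** (1988) 1–22 [Balaban1988RG2Cluster] (cell paper B13;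
journal page = PDF page).  [I] = T. Bałaban, *Renormalization group approach to lattice gauge field theories. I*, Commun.
Math. Phys. **109** (1987) 249–301 [Balaban1987RG1] (cell paper B12; PDF page = journal page − 248).  NOTHING IS NEWLY
QUOTED HERE: the sentences repeated in the docstrings below are those carried — and render-checked / cross-read — by the
imported tree modules: [II] Lemma 3 p. 20 with (2.38), p. 21 (2.39)–(2.41) and *"To the above sum we can repeat all the
considerations and bounds of the paper [26], for κ sufficiently large, and ε₁ sufficiently small"*, *"At first we assume
that (1 − 10δ)½L = 1"* (`B13`, `B13Resummation`, `Beta.RemainderChainKP`; GAPS C-pv15-2, C-pv18-3 / C-pv11-8, C-an4-14 / C-pv27-33);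
[II] (2.11) p. 14 *"Z ∩ Z′ contains a cube, or a wall of a cube"*, (2.13) p. 14, p. 15 (restriction of the spaces), (1.26)
p. 8 *"Σ_{X∈𝐃_j, X⊃□′} exp(−κd_j(X)) ≤ O(1), (1.26) for κ sufficiently large"* (`B13Resummation`, `TreeLengthCubeSystem`,
`B13Closing`; C-pv22-4, C-B13-11); [I] §0 p. 257 *"We decompose the space T into the lattice of closed cubes of a size M,
where M = Lᵐ …"*, *"… divided by M, is the linear size of X, and is denoted by d_j(X)"*, p. 257 after (0.25) *"with a
sufficiently large constant κ"*, (4.4) p. 281, (4.35) p. 290, the B₃-sentence p. 282, (4.37) p. 291, (5.1) p. 292,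
(5.10) p. 293 *"∣Π_{μν}(x − y)∣ ≤ O(1)E₀ exp(−δ₁∣x − y∣), (5.10) with a positive constant δ₁ determined by δ₀, κ, and M
(e.g., δ₁ = 1/2min{δ₀, κM⁻¹})"*, (1.20)–(1.22) p. 264 (`B12Decay510`, `B12Decay510Window`, `B12Decay510Lattice`,
`Beta.RemainderChain`; C-b03g3-1, C-b03g3-2 / C-pv13g2-5, C-b03g4-3 / C-pv14-25, C-beta-18 / C-pv14-22).  Published
engine behind the (2.38) ⇒ (2.41) step: R. Kotecký, D. Preiss, Commun. Math. Phys. **103** (1986) 491–498, PROVED in the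
tree (`Literature.Probability.LatticeModels.ClusterExpansionKPBound`), not quoted.

WHAT THE TREE HAD.  (a) Row an4's chain at Lemma-3 grade `RemainderChainKP.ChainKP` (gen 6): per torus/window index n an
ABSTRACT `B13.StepData`, an ABSTRACT polymer `Geometry (St n).Dk1 (Cube n)` with its constants ν, κ₀, K₀, c₁ entering
three per-n numeric hypotheses `hlarge`, `hsmall`, `hA₂`, an ABSTRACT site geometry `Gn n` with metric `ρn n`, embeddings
`e n` and the four geometric leaves `hgeo`, `hcube`, `htree`, `hρ` as HYPOTHESES with abstract constants (c₁, K₀, K₁), and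
the coefficient `remCoeff d c α₂ B₃ c₁ K₀ K₁` in which c₁, K₀, K₁ are binders and the geometry slot is print's example
constant read with the letter M (`polConst α₂ B₃ κ δ₀ c.M c₁ K₀ K₁`, δ₁ = `delta1 δ₀ κ c.M`).  (b) Unit b03's (5.10) AT
THE RESOLUTION OF PRINT with every geometric leaf discharged on the site lattice (`B12Decay510Lattice.decay510_lattice`:
sites x ∈ ℤ^d, cubes of side M ≥ 1, ℓ¹ distances, δ₁ = ½min{δ₀, κ(Md)⁻¹}, C = 4E₀α₂⁻²B₃²e^{3Mdδ₁}K₀(4·2^d, 2d)K₁(d, δ₀/2);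
leaves `geomLeafL` (M′, c₁) = (M·d, 3), `cubeSumLeafL` K₁(d, a) M-uniform, `B12Decay510Window.treeLeaf` K₀(4·2^d, 2d) at
rate κ/2 ≥ κ₀(4·2^d, 2d)).  (c) Unit b13-g3's window step data `B13Closing.WindowStep B` (𝐃_{k+1} := unit pv22's
`TreeLengthCubeSystem.sys B`, definitionally) with the CONSTRUCTED polymer geometry `WindowStep.geom = geometry B`
(ν = 2d + 1, κ₀ = κ₀(4·2^d, 2d), K₀ = K₀(4·2^d, 2d), c₁ = 4·2^d; `geometry_consts`), `WindowStep.spRestr` / `.repr213`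
(the p. 15 property and (2.13) from their concrete window forms).  (a) was never instantiated on (b) + (c).

WHAT THIS MODULE PROVES (compositions by name + [folklore] arithmetic; zero `sorry`).
§1  THE NUMERIC CONDITIONS AS FOUR NUMBERS `CondsL d c ℓ`: `large` (κ + 2κ₀(4·2^d, 2d) + 2 ≤ (1 − 8δ)ℓκ — [II] p. 21 «κ
    sufficiently large», Kotecký–Preiss form), `small` (C₃ε₁e^{5κ+1}K₀(4·2^d, 2d)(2d + 1)4·2^d ≤ 1 — «ε₁ sufficiently
    small»), `A₂` (e(2d + 1)4·2^d K₀(4·2^d, 2d)² ≤ A₂ — the O(1) of (2.41)), and `tree` (κ₀(4·2^d, 2d) ≤ κ/2 — the [I]-side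
    domain sum (0.26)/(1.26) at HALF rate, which the abstract leaf `htree` HID and the concrete carrier EXPOSES as one more
    restriction of the printed type «κ sufficiently large»); DERIVED signs `CondsL.kappa_pos` (κ > 0), `CondsL.remActivity_nonneg`
    (A_rem ≥ 0); `CondsL.tree_of_large` (under `(1 − 10δ)ℓ = 1`, ℓ ≤ 6, κ ≥ 0: `large ⇒ tree`; for the printed «L large» the
    two are independent); d = 4 in numerals `condsL_four_iff` (κ₀ = 64 log 162, ν = 9, c₁ = 64, K₀ = K₀(64, 8); `tree` ⟺
    `128 log 162 ≤ κ`); the residual sign bundle `SignsL` (C₃ε₁ ≥ 0, α₂ > 0, B₃ ≥ 0, δ₀ > 0).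
§2  THE CONSTANTS AS CLOSED FORMULAS: `deltaL d M c = ½min{δ₀, κ(Md)⁻¹}` (`deltaL_pos`); `polConstL d M c α₂ B₃ =
    4α₂⁻²B₃²e^{3Mdδ₁}K₀(4·2^d, 2d)K₁(d, δ₀/2)` (= `RemainderChain.polConst` at the lattice slots; `polConstL_eq`, `_nonneg`);
    `remCoeffL d M c α₂ B₃ = A₂·C₃·β′_d(K_Π,L, δ₁)` (`eps1_mul_remCoeffL`, `remCoeffL_eq` down to the printed letters and the
    lattice sum Σ_x∣x∣₁²e^{−δ₁∣x∣₁}); d = 4: `polConstL_four` (δ₁ = ½min{δ₀, κ(4M)⁻¹}, K_Π,L = 4α₂⁻²B₃²e^{12Mδ₁}K₀(64, 8)K₁(4, δ₀/2)).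
§3  THE LEAF LIST ON THE CONCRETE CARRIER `PolLeavesL d M P c ℓ α₂ B₃`: windows `B n ⊂ ℤ^d`, window step data `W n`,
    `SpRestr` / `Repr213` over the constructed geometry, (2.38)_ℓ, the (4.4) seam (`emb`, `hemb`, `hcomp`), and the ANALYTIC
    [I] leaves only (`han`, `hrepr`, `hh` with dist(x, X) := the ℓ¹ distance from the site to the nearest cube of X, `hlim`) —
    NO geometric field; `PolLeavesL.h118` (the (I.1.18)-leaf DERIVED on each window, `RemainderChainKP.h118_linear_of_KP` at
    `geometry (B n)`); `PolLeavesL.toPolLeaves : PolLeaves d P (remActivity c) α₂ B₃ κ δ₀ (M·d) 3 (K₀(4·2^d, 2d)) (K₁(d, δ₀/2))`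
    (geometric leaves SUPPLIED: `geomLeafL`, `cubeSumLeafL`, `treeLeaf`, `hρ` by `l1_neg`); `PolLeavesL.decay510 :
    Decay510 P (A_rem · K_Π,L) δ₁`.
§4  THE CHAIN `ChainL d M μ ν S γ c ℓ α₂ B₃` (`P1`, the dictionary clause `beta1_eq`, the concrete leaves per (k, p)) and
    `ChainL.abs_beta1_le : CondsL d c ℓ → R22gen ℓ → SignsL c α₂ B₃ → 0 < d → 0 < M → RemainderConst S γ (ε₁ · remCoeffL d M c α₂ B₃)`
    — the k-UNIFORM constant-form remainder bound with a FULLY VALUED coefficient; `ChainL.neg_le_beta1` (the one-sided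
    binder shape of RULING (R10)); `ChainL.abs_beta1_le_four` (d = 4, every constant a numeral or a printed letter).
§5  The RULING (R10) END consumers BY NAME (`Beta.DriftRemainder` §4 at `RemainderConst` grade):
    `betaPartialSumsLowerH_of_telescope_chainL`, `endpointExistence_of_telescope_chainL` (`ε₁·K_rem,L ≤ b·log L`); and the
    satisfiability of the ε₁-restrictions at fixed L with the valued coefficient and the valued Kotecký–Preiss rate,
    `exists_eps1_remCoeffL` (`RemainderChainKP.exists_eps1_lt_and_le`).  The wall's slot
    (`Beta.ComposedRoad.endpointExistence_of_composedLegInterfacePow_identity_remainderConst`, binders `(hrem : RemainderConst S γ₀ r)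
    (hr : r ≤ stepBal N Lc)`) and the co-lead's (`Beta.ConstRemainderConsumers`, `Beta.AveragedAFCarrier.betaAvgAFH_of_driftRemainderConst`,
    `r < b`) consume `ChainL.abs_beta1_le` with `r := ε₁ · remCoeffL d M c α₂ B₃` unchanged.
§6  (v1.1) The four numbers as THREE EXPLICIT THRESHOLDS in printed order: `kappaThresholdL d ℓ = max{10(κ₀+1)/(ℓ−1), 2κ₀}`,
    `a2ThresholdL d`, `eps1ThresholdL d κ = (e^{5κ+1}K₀(2d+1)4·2^d)⁻¹ > 0`; `large_and_tree_iff_of_R22gen`,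
    `small_iff_eps1ThresholdL`, `condsL_iff_thresholds` (`CondsL d c ℓ ⟺ κ_thr ≤ κ ∧ A₂_thr ≤ A₂ ∧ C₃ε₁ ≤ ε₁_thr(κ)` under
    `(1 − 10δ)ℓ = 1`, ℓ > 1), `CondsL.of_thresholds`; `kappaThresholdL_half` (ℓ = L/2: `max{20(κ₀+1)/(L−2), 2κ₀}` — the
    Kotecký–Preiss largeness and the [I]-side tree-sum restriction side by side), `kappaThresholdL_half_le_of_KP` (for
    2 < L ≤ 12 the KP largeness alone suffices), `kappaThresholdL_four`; `ChainL.abs_beta1_le_of_thresholds`.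
CONSTANTS' k-DEPENDENCE (the row's deliverable, cell record `BETA/REMAINDER-BETA.md` §2): in `ChainL` ONE `c : B13.Consts`,
ONE ℓ, ONE (α₂, B₃) and ONE cube side M serve EVERY scale k, EVERY history in `]0,γ]^{k+1}` and EVERY window index n; the
conditions `CondsL d c ℓ` and the coefficient `remCoeffL d M c α₂ B₃` mention neither k, nor the history, nor γ, nor the
window — k-uniformity and volume-uniformity are SYNTACTIC.  That the printed objects satisfy the analytic leaves with such
constants is what print asserts display by display (REMAINDER-BETA §2 table) and is NOT proved here.

DIVERGENCE (inherited, recorded in the cell file; nothing added).  (i) The finite-volume approximants are exhausting WINDOWS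
of cubes B n ⊂ ℤ^d with free boundary, not the periodic tori T₁^{(k+1)} of print — on BOTH sides: the [II] polymer
expansion (`B13Closing.WindowStep`, D-b13.11; pv22 caveat (i), D-pv22.3) and the [I] (5.10) geometry (`B12Decay510Lattice`,
D-b03.11 (ii), D-b03.14 (i)); the limit (5.1) is the hypothesis `hlim`, so the window choice constrains only which
finite-volume objects a future discharger must supply.  The [II]-side torus carrier EXISTS (`TreeLengthTorusGeometry.TorusStep`,
same constants, `RemainderChainKP.kpConds_tgeometry_four`); a (5.10) site geometry on the torus is NOT in the tree (b03
lineage scope), whence the window carrier here.  (ii) ∣x − y∣ and dist(X, ·) in the ℓ¹ reading (D-b03.14 (ii)): the printed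
example constant's M appears as M·d, δ₁ = ½min{δ₀, κ(Md)⁻¹}; c₁ = 3 (D-b03.14 (iii)).  Consequently `ChainL` is NOT routed
through `ChainKP` / `RemainderChain.Chain` (whose geometry slot is the letter `c.M`) but through `RemainderChain.PolLeaves`
with the slot `M·d`; the (2.41)-grade and Lemma-3-grade abstract chains remain available for any other carrier.
(iii) (4.35) is taken as printed (r = 2 only, *"by the identity (4.14)"*); the variant keeping the r = 1 term of (4.3)
(`B12Decay510Lattice.decay510_lattice_r1`, constant + E₀α₂⁻¹B₃′) is not instantiated here.

WHAT IS NOT HERE.  Lemma 3 itself (pp. 12–20; GAPS G-B13-07…10), (2.13)/(I.1.7) for Bałaban's E^{(k+1)} and the p. 15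
restriction property (`hrep`, `hsp`: binders, now over the constructed geometry), the [I] analytic leaves (G-B12s-15 (a),
(e)–(g); G-adv2-2 for (5.1)), the dictionary clause `beta1_eq` ((1.20)/(1.22) applied to the (2.13)-half), the one-loop side
(AF-0)/(M2⁺) — the sub-cell's wall — and `BetaPertH`.  No closed form for the lattice sums K₁(d, a) = Σ_{z∈ℤ^d}e^{−a∣z∣₁}
(= coth(a/2)^d) and Σ_x∣x∣₁²e^{−δ₁∣x∣₁} is claimed (named convergent sums, `B12Decay510Window.K₁`, `B12Sec2to5.betaPrime510`).
VERSIONS.  v1 (p182103); v1.1 (p182181: §6 appended, every v1 declaration unchanged); v1.2 (this file): DOCSTRINGS ONLY —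
two [cite:] locators corrected after the cross-read GAPS C-pv03-33 / G-pv03-15 (`PolLeavesL`: (5.1) is p. 292, p. 264 carries
only the «T₁^{(j+1)} ↗ Z^d» prose before (1.22); `kappaThresholdL_half`: the line «(1 − 10δ)·½L = 1» is p. 21 after (2.41),
(2.22) being the p. 16 Chebyshev bound); every declaration byte-unchanged.
References (CONTEXT ONLY): [I] T. Bałaban, CMP 109 (1987) 249–301; [II] T. Bałaban, CMP 116 (1988) 1–22; R. Kotecký,
D. Preiss, CMP 103 (1986) 491–498; [B16] T. Bałaban, CMP 122 (1989) 355–392, p. 355.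
-/

namespace Literature.MathematicalPhysics.QuantumFieldTheory.Balaban1983to89.Beta.RemainderChainLattice

open Literature.MathematicalPhysics.QuantumFieldTheory.Balaban1983to89
open FlowStep DagBinding FlowStepRuns
open Literature.MathematicalPhysics.QuantumFieldTheory.Balaban1983to89.B13ScaleTransfer (Pt)
open Literature.MathematicalPhysics.QuantumFieldTheory.Balaban1983to89.B13Resummation (Geometry SpRestr Repr213)
open Literature.MathematicalPhysics.QuantumFieldTheory.Balaban1983to89.B12TreeDecay (kappa₀ a₀ K₀ K₀_pos kappa₀_nonneg)
open Literature.MathematicalPhysics.QuantumFieldTheory.Balaban1983to89.TreeLength (treeLen)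
open Literature.MathematicalPhysics.QuantumFieldTheory.Balaban1983to89.TreeLengthCubeSystem
  (Dom sys cubeSys Cell geometry kappa₀_four)
open Literature.MathematicalPhysics.QuantumFieldTheory.Balaban1983to89.B13Closing (WindowStep)
open Literature.MathematicalPhysics.QuantumFieldTheory.Balaban1983to89.B12Decay510 (delta1 delta1_pos mixedDeriv)
open Literature.MathematicalPhysics.QuantumFieldTheory.Balaban1983to89.B12Decay510Window (K₁ K₁_nonneg treeLeaf l1_neg)
open Literature.MathematicalPhysics.QuantumFieldTheory.Balaban1983to89.B12Decay510Lattice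
  (distCube nearL geomL geomLeafL cubeSumLeafL)
open Literature.MathematicalPhysics.QuantumFieldTheory.Balaban1983to89.B12Sec2to5 (l1)
open Literature.MathematicalPhysics.QuantumFieldTheory.Balaban1983to89.Beta.RemainderChain
open Literature.MathematicalPhysics.QuantumFieldTheory.Balaban1983to89.Beta.RemainderChainKP (h118_linear_of_KP)
open Literature.MathematicalPhysics.QuantumFieldTheory.Balaban1983to89.Beta.DriftRemainder
  (betaPartialSumsLowerH_of_telescope_remainderConst endpointExistence_of_telescope_remainderConst)
open Metric Filter Topology

noncomputable section

variable {d : ℕ}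

/-! ## 1. The numeric conditions of the concrete carrier: FOUR k-free, volume-free NUMBERS -/

/-- `κ₀ > 0`: `κ₀(c₀, Δ) = c₀ log(2(Δ+1)²)` with `2(Δ+1)² ≥ 2`. [folklore] -/
theorem kappa₀_pos {c₀ : ℝ} (hc₀ : 0 < c₀) (Δ : ℕ) : 0 < kappa₀ c₀ Δ := by
  unfold kappa₀ a₀
  refine mul_pos hc₀ (Real.log_pos ?_)
  have : (0 : ℝ) ≤ (Δ : ℝ) := Nat.cast_nonneg _
  nlinarith

/-- **THE NUMERIC CONDITIONS OF THE (2.38) ⟹ (1.22) CHAIN ON THE CONCRETE CARRIER** (cubes of side M of ℤ^d,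
localization domains = non-empty face-connected families of cubes, d_j := tree length): the three conditions of
`RemainderChainKP` §1 with the constants of the CONSTRUCTED polymer geometry `TreeLengthCubeSystem.geometry`
(ν = 2d + 1, κ₀ = κ₀(4·2^d, 2d), K₀ = K₀(4·2^d, 2d), c₁ = 4·2^d) — `large` := [II] p. 21 *"κ sufficiently large"* in
the Kotecký–Preiss form, `small` := [II] p. 21 *"ε₁ sufficiently small"*, `A₂` := the printed O(1) of (2.41)
`≥ e·ν·c₁·K₀²` — and the [I]-side condition that was hidden in the abstract tree leaf `htree` of
`RemainderChain.PolLeaves` / `RemainderChainKP.PolLeavesKP` and is EXPLICIT on the concrete carrier: `tree` := the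
domain sum (0.26)/(1.26) at HALF the rate, `κ/2 ≥ κ₀(4·2^d, 2d)` ([I] p. 257 after (0.25) *"with a sufficiently large
constant κ"*; [II] (1.26) p. 8 *"for κ sufficiently large"*; `B12Decay510Window.treeLeaf`).  All four are inequalities
between k-free, volume-free, history-free numbers. [cite: Balaban1988RG2Cluster, p.21 (after (2.39)); Balaban1987RG1, (0.25)–(0.26) p.257] -/
structure CondsL (d : ℕ) (c : B13.Consts) (ℓ : ℝ) : Prop where
  large : c.κ + 2 * kappa₀ (4 * 2 ^ d) (2 * d) + 2 ≤ (1 - 8 * c.δ) * ℓ * c.κ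
  small : c.C3act * c.ε₁ * Real.exp (5 * c.κ + 1) * K₀ (4 * 2 ^ d) (2 * d) * (2 * (d : ℝ) + 1) * (4 * 2 ^ d) ≤ 1
  A₂ : Real.exp 1 * (2 * (d : ℝ) + 1) * (4 * 2 ^ d) * K₀ (4 * 2 ^ d) (2 * d) ^ 2 ≤ c.A₂
  tree : kappa₀ (4 * 2 ^ d) (2 * d) ≤ c.κ / 2

/-- The `tree` condition forces `κ > 0` (`κ₀ > 0`): the sign hypothesis `0 < c.κ` of `RemainderChain.ChainSigns` is
DERIVED on the concrete carrier. [folklore] -/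
theorem CondsL.kappa_pos {c : B13.Consts} {ℓ : ℝ} (hC : CondsL d c ℓ) : 0 < c.κ := by
  have := kappa₀_pos (c₀ := 4 * 2 ^ d) (by positivity) (2 * d)
  linarith [hC.tree]

/-- The `A₂` condition forces `A₂ ≥ 0`, hence `A_rem = A₂·C₃·ε₁ ≥ 0` once `C₃ε₁ ≥ 0`: the sign hypothesis `act` of
`RemainderChain.ChainSigns` is DERIVED on the concrete carrier. [folklore] -/
theorem CondsL.remActivity_nonneg {c : B13.Consts} {ℓ : ℝ} (hC : CondsL d c ℓ) (hA : 0 ≤ c.C3act * c.ε₁) :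
    0 ≤ remActivity c := by
  have hK := K₀_pos (4 * 2 ^ d) (2 * d)
  have hA₂ : 0 ≤ c.A₂ := le_trans (by positivity) hC.A₂
  rw [remActivity, mul_assoc]
  exact mul_nonneg hA₂ hA

/-- Under the closing condition `(1 − 10δ)ℓ = 1` with `ℓ ≤ 6` (printed ℓ = ½L: `L ≤ 12`) and `κ ≥ 0`, `large` implies
`tree` (`large ↔ 10(κ₀ + 1) ≤ (ℓ − 1)κ`, `RemainderChainKP.large_iff_of_R22gen`); for the printed *"L large"* the two are
independent restrictions on κ of the same printed type. [folklore] -/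
theorem CondsL.tree_of_large (c : B13.Consts) {ℓ : ℝ} (h22 : c.R22gen ℓ) (hℓ : ℓ ≤ 6) (hκ : 0 ≤ c.κ)
    (hlarge : c.κ + 2 * kappa₀ (4 * 2 ^ d) (2 * d) + 2 ≤ (1 - 8 * c.δ) * ℓ * c.κ) :
    kappa₀ (4 * 2 ^ d) (2 * d) ≤ c.κ / 2 := by
  rw [RemainderChainKP.large_iff_of_R22gen c h22] at hlarge
  nlinarith [hlarge, hℓ, hκ]

/-- d = 4 (the papers' dimension): the four conditions in NUMERALS — κ₀ = 64 log 162, ν = 9, c₁ = 64, K₀ = K₀(64, 8)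
(`TreeLengthCubeSystem.kappa₀_four`); in particular `tree` reads `128 log 162 ≤ κ`. [cite: Balaban1988RG2Cluster, p.21 (after (2.39)); Balaban1987RG1, (0.25)–(0.26) p.257] -/
theorem condsL_four_iff (c : B13.Consts) (ℓ : ℝ) : CondsL 4 c ℓ ↔
    (c.κ + 2 * (64 * Real.log 162) + 2 ≤ (1 - 8 * c.δ) * ℓ * c.κ) ∧
      (c.C3act * c.ε₁ * Real.exp (5 * c.κ + 1) * K₀ 64 8 * 9 * 64 ≤ 1) ∧
      (Real.exp 1 * 9 * 64 * K₀ 64 8 ^ 2 ≤ c.A₂) ∧ (128 * Real.log 162 ≤ c.κ) := by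
  have hκ₀ : kappa₀ (4 * 2 ^ 4) (2 * 4) = 64 * Real.log 162 := kappa₀_four
  have h64 : (4 : ℝ) * 2 ^ 4 = 64 := by norm_num
  have h9 : 2 * ((4 : ℕ) : ℝ) + 1 = 9 := by norm_num
  have hK : K₀ (4 * 2 ^ 4) (2 * 4) = K₀ 64 8 := by norm_num
  constructor
  · rintro ⟨h1, h2, h3, h4⟩
    rw [hκ₀] at h1 h4
    rw [hK, h9, h64] at h2 h3
    exact ⟨h1, h2, h3, by linarith⟩
  · rintro ⟨h1, h2, h3, h4⟩
    refine ⟨?_, ?_, ?_, ?_⟩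
    · rw [hκ₀]; exact h1
    · rw [hK, h9, h64]; exact h2
    · rw [hK, h9, h64]; exact h3
    · rw [hκ₀]; linarith

/-- The signs of the printed constants used by the concrete chain: `C₃ε₁ ≥ 0`, α₂ > 0, B₃ ≥ 0, δ₀ > 0 (κ > 0, K₀ ≥ 0,
A_rem ≥ 0, M′ > 0 being DERIVED: `CondsL.kappa_pos`, `B12TreeDecay.K₀_pos`, `CondsL.remActivity_nonneg`, `0 < M·d`).
[folklore] -/
structure SignsL (c : B13.Consts) (α₂ B₃ : ℝ) : Prop where
  A : 0 ≤ c.C3act * c.ε₁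
  α₂_pos : 0 < α₂
  B₃_nonneg : 0 ≤ B₃
  δ₀_pos : 0 < c.δ₀

/-! ## 2. The constants of the concrete carrier: `δ₁`, `K_Π`, `K_rem` as closed formulas in (d, M, c, α₂, B₃) -/

/-- The (5.10)-rate on the site lattice in the ℓ¹ reading: `δ₁ := ½ min{δ₀, κ(Md)⁻¹}` = `delta1 δ₀ κ (M·d)`
(`B12Decay510Lattice.decay510_lattice`; print's example constant ½min{δ₀, κM⁻¹}, p. 293, with its M read as M·d against
the sup-metric tree length — cell DIVERGENCE D-b03.14 (ii)). [cite: Balaban1987RG1, (5.10) p.293] -/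
def deltaL (d M : ℕ) (c : B13.Consts) : ℝ := delta1 c.δ₀ c.κ ((M : ℝ) * d)

/-- `δ₁ > 0` on the concrete carrier (δ₀ > 0, κ > 0 from `tree`, M, d ≥ 1). [folklore] -/
theorem deltaL_pos {M : ℕ} {c : B13.Consts} {ℓ : ℝ} (hC : CondsL d c ℓ) (hδ₀ : 0 < c.δ₀) (hd : 0 < d) (hM : 0 < M) :
    0 < deltaL d M c :=
  delta1_pos hδ₀ hC.kappa_pos (mul_pos (Nat.cast_pos.2 hM) (Nat.cast_pos.2 hd))

/-- The activity-free (5.10)-constant on the concrete carrier: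
`K_Π,L := 4 α₂⁻² B₃² e^{3·M·d·δ₁} K₀(4·2^d, 2d) K₁(d, δ₀/2)` = `RemainderChain.polConst` at the lattice geometry's slots
(M′, c₁, K₀, K₁) = (M·d, 3, K₀(4·2^d, 2d), K₁(d, δ₀/2)) (`B12Decay510Lattice.geomLeafL`, `cubeSumLeafL`,
`B12Decay510Window.treeLeaf`) — a closed formula in (d, M, δ₀, κ, α₂, B₃): k-free, volume-free, history-free, ε₁-free.
[cite: Balaban1987RG1, (5.10) p.293] -/
def polConstL (d M : ℕ) (c : B13.Consts) (α₂ B₃ : ℝ) : ℝ :=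
  polConst α₂ B₃ c.κ c.δ₀ ((M : ℝ) * d) 3 (K₀ (4 * 2 ^ d) (2 * d)) (K₁ d (c.δ₀ / 2))

/-- `K_Π,L` unfolded: `4/α₂² · B₃² · e^{δ₁·(M·d)·3} · K₀(4·2^d, 2d) · K₁(d, δ₀/2)`, `δ₁ = deltaL d M c`. [folklore] -/
theorem polConstL_eq (d M : ℕ) (c : B13.Consts) (α₂ B₃ : ℝ) : polConstL d M c α₂ B₃ =
    4 / α₂ ^ 2 * B₃ ^ 2 * Real.exp (deltaL d M c * ((M : ℝ) * d) * 3) * K₀ (4 * 2 ^ d) (2 * d) *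
      K₁ d (c.δ₀ / 2) := rfl

/-- `K_Π,L ≥ 0`. [folklore] -/
theorem polConstL_nonneg (d M : ℕ) (c : B13.Consts) (α₂ B₃ : ℝ) : 0 ≤ polConstL d M c α₂ B₃ :=
  polConst_nonneg (K₀_pos _ _).le (K₁_nonneg _ _)

/-- **THE REMAINDER COEFFICIENT ON THE CONCRETE CARRIER**: `K_rem,L := O(1) · C₃ · β′_d(K_Π,L, δ₁)` with
`β′_d(K, δ₁) = K · Σ_{x∈ℤ^d} |x|₁² e^{−δ₁|x|₁}` (`B12Sec2to5.betaPrime510`) — so that the chain gives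
`|β¹_{k+1}| ≤ ε₁ · K_rem,L`.  A closed formula in (d, M) and the printed analytic constants (L, q, κ, κ₁, δ₀, E₀, C₁, C₂,
α₄, α₆ through C₃; the O(1)'s A₁, A₂; α₂, B₃): EVERY geometric constant of `RemainderChain.remCoeff` (c₁, K₀, K₁ and the
O(1) of (2.41) behind A₂'s lower bound) is now a NUMBER.  ε₁-free, k-free, history-free, volume-free.
[cite: Balaban1988RG2Cluster, p.20 (definition of C₃); Balaban1987RG1, (5.10) p.293 and (1.22) p.264] -/
def remCoeffL (d M : ℕ) (c : B13.Consts) (α₂ B₃ : ℝ) : ℝ :=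
  c.A₂ * c.C3act * B12Sec2to5.betaPrime510 d (polConstL d M c α₂ B₃) (deltaL d M c)

/-- `ε₁ · K_rem,L = A_rem · β′_d(K_Π,L, δ₁)`. [folklore] -/
theorem eps1_mul_remCoeffL (d M : ℕ) (c : B13.Consts) (α₂ B₃ : ℝ) :
    c.ε₁ * remCoeffL d M c α₂ B₃ =
      remActivity c * B12Sec2to5.betaPrime510 d (polConstL d M c α₂ B₃) (deltaL d M c) := by
  unfold remCoeffL remActivity; ring

/-- `K_rem,L` unfolded to the printed letters: `A₂ · C₃ · (4α₂⁻²B₃² e^{3Mdδ₁} K₀(4·2^d,2d) K₁(d,δ₀/2)) · Σ_x |x|₁² e^{−δ₁|x|₁}`.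
[folklore] -/
theorem remCoeffL_eq (d M : ℕ) (c : B13.Consts) (α₂ B₃ : ℝ) : remCoeffL d M c α₂ B₃ =
    c.A₂ * c.C3act * (4 / α₂ ^ 2 * B₃ ^ 2 * Real.exp (deltaL d M c * ((M : ℝ) * d) * 3) * K₀ (4 * 2 ^ d) (2 * d) *
      K₁ d (c.δ₀ / 2) * ∑' x : Fin d → ℤ, l1 x ^ 2 * Real.exp (-(deltaL d M c) * l1 x)) := by
  rw [remCoeffL, B12Sec2to5.betaPrime510, polConstL_eq]

/-- d = 4: `δ₁ = ½ min{δ₀, κ(4M)⁻¹}` and `K_Π,L = 4α₂⁻²B₃² e^{12Mδ₁} K₀(64, 8) K₁(4, δ₀/2)`. [cite: Balaban1987RG1, (5.10) p.293] -/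
theorem polConstL_four (M : ℕ) (c : B13.Consts) (α₂ B₃ : ℝ) :
    deltaL 4 M c = delta1 c.δ₀ c.κ (4 * (M : ℝ)) ∧
      polConstL 4 M c α₂ B₃ = 4 / α₂ ^ 2 * B₃ ^ 2 * Real.exp (12 * (M : ℝ) * delta1 c.δ₀ c.κ (4 * (M : ℝ))) *
        K₀ 64 8 * K₁ 4 (c.δ₀ / 2) := by
  have hK : K₀ (4 * 2 ^ 4) (2 * 4) = K₀ 64 8 := by norm_num
  have hM : ((M : ℝ) * ((4 : ℕ) : ℝ)) = 4 * (M : ℝ) := by push_cast; ring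
  have hδ : deltaL 4 M c = delta1 c.δ₀ c.κ (4 * (M : ℝ)) := by rw [deltaL, hM]
  refine ⟨hδ, ?_⟩
  rw [polConstL_eq, hK, hδ, hM]
  congr 2
  ring_nf

/-! ## 3. The leaf list on the concrete carrier: windows of ℤ^d, window step data, the site lattice -/

/-- **THE LEAVES OF THE REMAINDER POLARIZATION ON THE CONCRETE CARRIER** (cf. `RemainderChainKP.PolLeavesKP`, whose
polymer `Geometry`, site geometry `Gn`, metric `ρn`, embeddings `e` and the four geometric leaves `hgeo`, `hcube`,
`htree`, `hρ` are here CONSTRUCTED / PROVED, not fields): for each index n of the exhausting family (the `T ↗ ℤ^d`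
limit of [I] p. 264, (5.1) p. 292) — a finite window `B n ⊂ ℤ^d` of cubes; the [II]-side step data `W n` WITH 𝐃_{k+1} := the
localization domains inside the window and d_{k+1} := tree length (`B13Closing.WindowStep`, unit b13-g3, over unit pv22's
`TreeLengthCubeSystem.sys`), the restriction property of the spaces (p. 15) and the representation (2.13) over the
CONSTRUCTED polymer geometry `TreeLengthCubeSystem.geometry (B n)` (= `(W n).geom`; their concrete window forms are
`B13Closing.WindowStep.spRestr` / `.repr213`), Lemma 3's bound (2.38)_ℓ on the activities; the [I] (4.4) seam (`emb`,
`hemb`, `hcomp`); and the [I] §§4–5 ANALYTIC leaves at the resolution of print — sites = lattice points x ∈ ℤ^d, cubes of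
side M (`B12Decay510Lattice`, unit b03-g4): analyticity on the α₂-ball, the polarization terms as second derivatives
((4.35), `hrepr`), the minimizer decay `B₃e^{−δ₀ dist(x, X)}` with dist(x, X) := the ℓ¹ distance from the site to the
nearest cube of X (p. 282, `hh`), and the limit (5.1) at the sites 0, z (`hlim`).  ONE `c`, ONE ℓ, ONE (α₂, B₃), ONE M for
all n.  A HYPOTHESIS structure: nothing of it is discharged here; NO geometric hypothesis is left in it.  The normed-space
structures of the external-field spaces are FIELDS (no global instance is registered).
[cite: Balaban1988RG2Cluster, (2.38) p.20 and (2.13) p.14; Balaban1987RG1, (4.4) p.281, (4.35) p.290 and (5.1) p.292] -/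
structure PolLeavesL (d M : ℕ) (P : (Fin d → ℤ) → ℝ) (c : B13.Consts) (ℓ α₂ B₃ : ℝ) where
  B : ℕ → Finset (Pt d)
  W : (n : ℕ) → WindowStep (B n)
  hsp : ∀ n, SpRestr (W n).toStepData (W n).geom
  hrep : ∀ n, Repr213 (W n).toStepData (W n).geom
  h238 : ∀ n, B13.Bound238With (W n).toStepData c ℓ
  Wn : ℕ → Type
  [instW : ∀ n, NormedAddCommGroup (Wn n)]
  [instWs : ∀ n, NormedSpace ℂ (Wn n)]
  EXn : (n : ℕ) → Dom (B n) → Wn n → ℂ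
  emb : (n : ℕ) → Dom (B n) → Wn n → (W n).Φ
  hemb : ∀ n X, ∀ v ∈ ball (0 : Wn n) α₂, emb n X v ∈ (W n).sp2 X
  hcomp : ∀ n X v, EXn n X v = (W n).Ek1 X (emb n X v)
  hn : (n : ℕ) → Dom (B n) → Pt d → Wn n
  E2n : (n : ℕ) → Dom (B n) → Pt d → Pt d → ℝ
  han : ∀ n X, AnalyticOnNhd ℂ (EXn n X) (ball 0 α₂)
  hrepr : ∀ n X x y, E2n n X x y = (mixedDeriv (EXn n X) (hn n X x) (hn n X y)).re
  hh : ∀ n X x, ‖hn n X x‖ ≤ B₃ * Real.exp (-c.δ₀ * distCube M x (nearL M (B n) x X))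
  hlim : ∀ z, Tendsto (fun n => ∑ X : Dom (B n), E2n n X 0 z) atTop (𝓝 (P z))

/-- **The (I.1.18)-leaf DERIVED on window n** (`RemainderChainKP.h118_linear_of_KP` at the constructed geometry): Lemma 3's
(2.38)_ℓ, `(1 − 10δ)ℓ = 1`, `C₃ε₁ ≥ 0` and the numeric conditions give
`‖E^{(k+1)}(X, emb v)‖ ≤ A_rem e^{−κ·treeLen X}` on the α₂-ball, `A_rem = O(1)C₃ε₁`. [cite: Balaban1988RG2Cluster, (2.38) p.20 and (2.41) p.21] -/
theorem PolLeavesL.h118 {M : ℕ} {P : (Fin d → ℤ) → ℝ} {c : B13.Consts} {ℓ α₂ B₃ : ℝ}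
    (Lv : PolLeavesL d M P c ℓ α₂ B₃) (hC : CondsL d c ℓ) (h22 : c.R22gen ℓ) (hA : 0 ≤ c.C3act * c.ε₁) (n : ℕ) :
    letI := Lv.instW n
    ∀ X, ∀ v ∈ ball (0 : Lv.Wn n) α₂, ‖Lv.EXn n X v‖ ≤ remActivity c * Real.exp (-c.κ * treeLen X.1) := by
  letI := Lv.instW n
  exact h118_linear_of_KP (Lv.W n).toStepData c ℓ (Lv.W n).geom (Lv.hsp n) (Lv.hrep n) (Lv.h238 n) h22 hA
    hC.kappa_pos.le hC.large hC.small hC.A₂ (Lv.emb n) (Lv.EXn n) (Lv.hemb n) (Lv.hcomp n)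

/-- **The concrete leaves give the leaves of `RemainderChain.PolLeaves`** with activity `A_rem = O(1)C₃ε₁`, rate κ and the
lattice geometry's slots (M′, c₁, K₀, K₁) = (M·d, 3, K₀(4·2^d, 2d), K₁(d, δ₀/2)) — the (I.1.18)-leaf DERIVED (§1 of
`RemainderChainKP`), the geometry leaf, cube sum and tree sum PROVED (`B12Decay510Lattice.geomLeafL`, `cubeSumLeafL`,
`B12Decay510Window.treeLeaf`), the metric leaf `hρ` trivial (sites = ℤ^d, |0 − z|₁ = |z|₁); the analytic leaves carried
over verbatim. [cite: Balaban1987RG1, (4.37) p.291 and (5.10) p.293; Balaban1988RG2Cluster, (2.38) p.20] -/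
def PolLeavesL.toPolLeaves {M : ℕ} {P : (Fin d → ℤ) → ℝ} {c : B13.Consts} {ℓ α₂ B₃ : ℝ}
    (Lv : PolLeavesL d M P c ℓ α₂ B₃) (hC : CondsL d c ℓ) (h22 : c.R22gen ℓ) (hs : SignsL c α₂ B₃) (hM : 0 < M) :
    PolLeaves d P (remActivity c) α₂ B₃ c.κ c.δ₀ ((M : ℝ) * d) 3 (K₀ (4 * 2 ^ d) (2 * d)) (K₁ d (c.δ₀ / 2)) where
  Sn := fun n => sys (Lv.B n)
  Cn := fun n => (cubeSys (Lv.B n)).toCubeCover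
  Λn := fun _ => Pt d
  Gn := fun n => geomL (Lv.B n) M
  ρn := fun _ x y => l1 (x - y)
  Wn := Lv.Wn
  instW := Lv.instW
  instWs := Lv.instWs
  EXn := Lv.EXn
  hn := Lv.hn
  E2n := Lv.E2n
  e := fun _ z => z
  han := Lv.han
  h118 := fun n => Lv.h118 hC h22 hs.A n
  hrepr := Lv.hrepr
  hh := Lv.hh
  hgeo := fun n => geomLeafL (Lv.B n) hM
  hcube := fun n => cubeSumLeafL (Lv.B n) hM (half_pos hs.δ₀_pos)
  htree := fun n => treeLeaf (Lv.B n) hC.tree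
  hρ := fun z => Eventually.of_forall fun n => by
    show l1 (0 - z) = l1 z
    rw [zero_sub, l1_neg]
  hlim := Lv.hlim

/-- **(L2)–(L3) on the concrete carrier**: the leaves give the (5.10)-decay of the limit kernel
`|P(x)| ≤ A_rem · K_Π,L · e^{−δ₁|x|₁}`, `δ₁ = ½ min{δ₀, κ(Md)⁻¹}`, with NO geometric hypothesis
(`RemainderChain.PolLeaves.decay510` ∘ `toPolLeaves`; = `B12Decay510Lattice.decay510_lattice` with E₀ := A_rem).
[cite: Balaban1987RG1, (5.10) p.293] -/
theorem PolLeavesL.decay510 {M : ℕ} {P : (Fin d → ℤ) → ℝ} {c : B13.Consts} {ℓ α₂ B₃ : ℝ}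
    (Lv : PolLeavesL d M P c ℓ α₂ B₃) (hC : CondsL d c ℓ) (h22 : c.R22gen ℓ) (hs : SignsL c α₂ B₃) (hd : 0 < d)
    (hM : 0 < M) :
    B12Sec2to5.Decay510 P (remActivity c * polConstL d M c α₂ B₃) (deltaL d M c) :=
  (Lv.toPolLeaves hC h22 hs hM).decay510 hs.α₂_pos (hC.remActivity_nonneg hs.A) hs.B₃_nonneg (K₀_pos _ _).le
    hs.δ₀_pos.le hC.kappa_pos.le (mul_pos (Nat.cast_pos.2 hM) (Nat.cast_pos.2 hd))

/-! ## 4. The chain on the concrete carrier and the k-UNIFORM bound with a fully valued coefficient -/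

/-- **THE REMAINDER CHAIN ON THE CONCRETE CARRIER** for the β-family `β` with one-loop split `S` on the boxes
`]0,γ]^{k+1}` (cf. `RemainderChainKP.ChainKP`): `P1 k p` = the `T ↗ ℤ^d` limit polarization kernel of the (2.13)-half at
scale k + 1 and history p; `beta1_eq` = the dictionary clause ((1.20)/(1.22) applied to that half); `leaves k p hp` = the
concrete leaf list with THE SAME `c, ℓ, α₂, B₃, M` for every k and every history.  A HYPOTHESIS structure.
[cite: Balaban1987RG1, (1.20)-(1.22) p.264; Balaban1988RG2Cluster, (2.38) p.20] -/
structure ChainL (d M : ℕ) (μ ν : Fin d) {β : HBeta} (S : B12Beta.OneLoopSplit β) (γ : ℝ) (c : B13.Consts)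
    (ℓ α₂ B₃ : ℝ) where
  P1 : (k : ℕ) → (Fin (k + 1) → ℝ) → B12Beta.Kernel d
  beta1_eq : ∀ k p, p ∈ B12Beta.HistBox γ k → S.β1 k p = B12Beta.secondMoment (P1 k p) μ ν
  leaves : ∀ k p, p ∈ B12Beta.HistBox γ k → PolLeavesL d M (P1 k p μ ν) c ℓ α₂ B₃

/-- **THE k-UNIFORM REMAINDER BOUND ON THE CONCRETE CARRIER, coefficient FULLY VALUED**: a concrete chain with the four
numeric conditions, `(1 − 10δ)ℓ = 1` and the printed signs gives `|β¹_{k+1}(g_0,…,g_k)| ≤ ε₁ · K_rem,L` for EVERY scale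
k and EVERY history in `]0,γ]^{k+1}`, `K_rem,L = remCoeffL d M c α₂ B₃` a closed formula in (d, M) and the printed
analytic constants — no abstract geometric constant (c₁, K₀, K₁, ν, κ₀) and no geometric leaf remains.  O(ε₁), not
O(g_k), not O(γ²). [cite: Balaban1988RG2Cluster, (2.38) p.20; Balaban1987RG1, (5.10) p.293 and (1.22) p.264] -/
theorem ChainL.abs_beta1_le {M : ℕ} {μ ν : Fin d} {β : HBeta} {S : B12Beta.OneLoopSplit β} {γ : ℝ} {c : B13.Consts}
    {ℓ α₂ B₃ : ℝ} (R : ChainL d M μ ν S γ c ℓ α₂ B₃) (hC : CondsL d c ℓ) (h22 : c.R22gen ℓ) (hs : SignsL c α₂ B₃)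
    (hd : 0 < d) (hM : 0 < M) : RemainderConst S γ (c.ε₁ * remCoeffL d M c α₂ B₃) := by
  intro k p hp
  have hδ₁ : 0 < deltaL d M c := deltaL_pos hC hs.δ₀_pos hd hM
  have hdec := (R.leaves k p hp).decay510 hC h22 hs hd hM
  rw [R.beta1_eq k p hp, eps1_mul_remCoeffL]
  exact abs_secondMoment_le_linear hδ₁ hdec

/-- The one-sided form `−ε₁K_rem,L ≤ β¹_{k+1}` on the boxes (the binder shape of RULING (R10)'s remainder slot). [folklore] -/
theorem ChainL.neg_le_beta1 {M : ℕ} {μ ν : Fin d} {β : HBeta} {S : B12Beta.OneLoopSplit β} {γ : ℝ} {c : B13.Consts}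
    {ℓ α₂ B₃ : ℝ} (R : ChainL d M μ ν S γ c ℓ α₂ B₃) (hC : CondsL d c ℓ) (h22 : c.R22gen ℓ) (hs : SignsL c α₂ B₃)
    (hd : 0 < d) (hM : 0 < M) :
    ∀ k (p : Fin (k + 1) → ℝ), p ∈ B12Beta.HistBox γ k → -(c.ε₁ * remCoeffL d M c α₂ B₃) ≤ S.β1 k p :=
  fun k p hp => (abs_le.mp (R.abs_beta1_le hC h22 hs hd hM k p hp)).1

/-- d = 4: the bound reads `|β¹_{k+1}| ≤ ε₁ · A₂ · C₃ · 4α₂⁻²B₃² e^{12Mδ₁} K₀(64,8) K₁(4,δ₀/2) · Σ_{x∈ℤ⁴}|x|₁²e^{−δ₁|x|₁}`,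
`δ₁ = ½ min{δ₀, κ(4M)⁻¹}`, under the numeral conditions of `condsL_four_iff`. [cite: Balaban1987RG1, (5.10) p.293 and (1.22) p.264] -/
theorem ChainL.abs_beta1_le_four {M : ℕ} {μ ν : Fin 4} {β : HBeta} {S : B12Beta.OneLoopSplit β} {γ : ℝ}
    {c : B13.Consts} {ℓ α₂ B₃ : ℝ} (R : ChainL 4 M μ ν S γ c ℓ α₂ B₃)
    (hlarge : c.κ + 2 * (64 * Real.log 162) + 2 ≤ (1 - 8 * c.δ) * ℓ * c.κ)
    (hsmall : c.C3act * c.ε₁ * Real.exp (5 * c.κ + 1) * K₀ 64 8 * 9 * 64 ≤ 1)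
    (hA₂ : Real.exp 1 * 9 * 64 * K₀ 64 8 ^ 2 ≤ c.A₂) (htree : 128 * Real.log 162 ≤ c.κ) (h22 : c.R22gen ℓ)
    (hs : SignsL c α₂ B₃) (hM : 0 < M) :
    RemainderConst S γ (c.ε₁ * (c.A₂ * c.C3act *
      B12Sec2to5.betaPrime510 4 (4 / α₂ ^ 2 * B₃ ^ 2 * Real.exp (12 * (M : ℝ) * delta1 c.δ₀ c.κ (4 * (M : ℝ))) *
        K₀ 64 8 * K₁ 4 (c.δ₀ / 2)) (delta1 c.δ₀ c.κ (4 * (M : ℝ))))) := by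
  have hC : CondsL 4 c ℓ := (condsL_four_iff c ℓ).2 ⟨hlarge, hsmall, hA₂, htree⟩
  obtain ⟨hδ, hK⟩ := polConstL_four M c α₂ B₃
  have h := R.abs_beta1_le hC h22 hs (by norm_num) hM
  rw [remCoeffL, hK, hδ] at h
  exact h

/-! ## 5. The RULING (R10) END consumers, by name -/

/-- **`BetaPartialSumsLowerH` from telescoping + the concrete chain** (`Beta.DriftRemainder.betaPartialSumsLowerH_of_telescope_remainderConst`
∘ `ChainL.abs_beta1_le`): (T1) `Σ_{j<k} β⁰_j = B(L^k)`, (T2) `|B(n) − b log n| ≤ A` (n ≥ 2), the chain, and the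
printed-type restriction `ε₁·K_rem,L ≤ b·log L` give `BetaPartialSumsLowerH (2A) γ₀ β`. [cite: Balaban1987RG1, Thm 2 p.259 (first sentence); Balaban1988RG2Cluster, (2.38) p.20] -/
theorem betaPartialSumsLowerH_of_telescope_chainL {M : ℕ} {μ ν : Fin d} {β : HBeta} {S : B12Beta.OneLoopSplit β}
    {γ₀ : ℝ} {c : B13.Consts} {ℓ α₂ B₃ b A : ℝ} {B : ℕ → ℝ} {L : ℕ} (R : ChainL d M μ ν S γ₀ c ℓ α₂ B₃)
    (hC : CondsL d c ℓ) (h22 : c.R22gen ℓ) (hs : SignsL c α₂ B₃) (hd : 0 < d) (hM : 0 < M) (hL : 2 ≤ L)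
    (hA : 0 ≤ A) (hTel : ∀ k : ℕ, ∑ j ∈ Finset.range k, S.β0 j = B (L ^ k))
    (hB : ∀ n : ℕ, 2 ≤ n → |B n - b * Real.log n| ≤ A)
    (hε₁ : c.ε₁ * remCoeffL d M c α₂ B₃ ≤ b * Real.log L) : BetaPartialSumsLowerH (2 * A) γ₀ β :=
  betaPartialSumsLowerH_of_telescope_remainderConst S hL hA hTel hB (R.abs_beta1_le hC h22 hs hd hM) hε₁

/-- **ENDPOINT EXISTENCE from telescoping + the concrete chain** ([I] Thm 2 first sentence for forward-generated
constructions; `Beta.DriftRemainder.endpointExistence_of_telescope_remainderConst` ∘ `ChainL.abs_beta1_le`).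
[cite: Balaban1987RG1, Thm 2 p.259 (first sentence); Balaban1988RG2Cluster, (2.38) p.20] -/
theorem endpointExistence_of_telescope_chainL {C : B12.Construction} {β : HBeta} (hgen : ForwardGenerated C β)
    {S : B12Beta.OneLoopSplit β} {M : ℕ} {μ ν : Fin d} {c : B13.Consts} {ℓ α₂ B₃ γ₀ b A β' : ℝ} {B : ℕ → ℝ}
    {L : ℕ} (R : ChainL d M μ ν S γ₀ c ℓ α₂ B₃) (hC : CondsL d c ℓ) (h22 : c.R22gen ℓ) (hs : SignsL c α₂ B₃)
    (hd : 0 < d) (hM : 0 < M) (hγ₀ : 0 < γ₀) (hL : 2 ≤ L) (hA : 0 ≤ A)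
    (hTel : ∀ k : ℕ, ∑ j ∈ Finset.range k, S.β0 j = B (L ^ k))
    (hB : ∀ n : ℕ, 2 ≤ n → |B n - b * Real.log n| ≤ A)
    (hε₁ : c.ε₁ * remCoeffL d M c α₂ B₃ ≤ b * Real.log L) (hβ' : 0 ≤ β') (hcont : BetaContH γ₀ β)
    (hup : BetaUpperH β' γ₀ β) : EndpointExistence C :=
  endpointExistence_of_telescope_remainderConst hgen S hγ₀ hL hA hTel hB (R.abs_beta1_le hC h22 hs hd hM) hε₁ hβ'
    hcont hup

/-- Satisfiability of the ε₁-restrictions at fixed `L ≥ 2` with the valued coefficient (`RemainderChainKP.exists_eps1_lt_and_le`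
at `K := K_rem,L`, `R :=` the ε₁-free Kotecký–Preiss rate `C₃e^{5κ+1}K₀(4·2^d,2d)(2d+1)4·2^d`): for `b > 0` there is
`ε₁ > 0` with `ε₁·K_rem,L < b·log L` STRICTLY and `ε₁·R ≤ 1`. [folklore] -/
theorem exists_eps1_remCoeffL (d M : ℕ) (c : B13.Consts) (α₂ B₃ b : ℝ) (hb : 0 < b) {L : ℕ} (hL : 2 ≤ L)
    (hC3 : 0 ≤ c.C3act) :
    ∃ ε₁ : ℝ, 0 < ε₁ ∧ ε₁ * remCoeffL d M c α₂ B₃ < b * Real.log L ∧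
      ε₁ * (c.C3act * Real.exp (5 * c.κ + 1) * K₀ (4 * 2 ^ d) (2 * d) * (2 * (d : ℝ) + 1) * (4 * 2 ^ d)) ≤ 1 := by
  have hK := K₀_pos (4 * 2 ^ d) (2 * d)
  exact RemainderChainKP.exists_eps1_lt_and_le b _ _ hb (by positivity) hL

/-! ## 6. (v1.1) The four numbers as THREE EXPLICIT THRESHOLDS in printed order (κ given ℓ; A₂ absolute; ε₁ given κ)

Under the generalised closing relation `(1 − 10δ)ℓ = 1` (`B13.Consts.R22gen`; printed `ℓ = L/2`) with `ℓ > 1`, the two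
κ-conditions `large ∧ tree` are EXACTLY one lower bound `κ_thr(d, ℓ) ≤ κ` with
`κ_thr(d, ℓ) = max{10(κ₀ + 1)/(ℓ − 1), 2κ₀}`, κ₀ = κ₀(4·2^d, 2d); `A₂` is the absolute bound `A₂_thr(d) ≤ A₂`; `small` is
`C₃ε₁ ≤ ε₁_thr(d, κ) = (e^{5κ+1}K₀(4·2^d, 2d)(2d + 1)4·2^d)⁻¹ > 0`.  So the printed *"κ sufficiently large … ε₁ sufficiently
small"* ([II] p. 21) and *"with a sufficiently large constant κ"* ([I] p. 257) of the concrete carrier are, in the kernel, the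
order "choose κ ≥ κ_thr(d, ℓ) (given L), then A₂ ≥ A₂_thr(d), then ε₁ with C₃ε₁ ≤ ε₁_thr(d, κ)" — every threshold k-free and
volume-free [analysis: naming the thresholds is ours; the inequalities are the fields of `CondsL` rearranged; folklore algebra]. -/

/-- The κ-threshold of the concrete carrier: `max{10(κ₀ + 1)/(ℓ − 1), 2κ₀}`, κ₀ = κ₀(4·2^d, 2d) (our name for the printed
*"κ sufficiently large"* on this carrier). [cite: Balaban1988RG2Cluster, p.21 (after (2.39)); Balaban1987RG1, (0.25)–(0.26) p.257] -/
def kappaThresholdL (d : ℕ) (ℓ : ℝ) : ℝ :=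
  max (10 * (kappa₀ (4 * 2 ^ d) (2 * d) + 1) / (ℓ - 1)) (2 * kappa₀ (4 * 2 ^ d) (2 * d))

/-- The absolute A₂-threshold `e(2d + 1)4·2^d K₀(4·2^d, 2d)²` (the explicit O(1) of (2.41) on the window geometry). [cite: Balaban1988RG2Cluster, (2.41) p.21] -/
def a2ThresholdL (d : ℕ) : ℝ := Real.exp 1 * (2 * (d : ℝ) + 1) * (4 * 2 ^ d) * K₀ (4 * 2 ^ d) (2 * d) ^ 2

/-- The ε₁-threshold given κ: `(e^{5κ+1}K₀(4·2^d, 2d)(2d + 1)4·2^d)⁻¹` (our name for the printed *"ε₁ sufficiently small"* on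
this carrier, Kotecký–Preiss form). [cite: Balaban1988RG2Cluster, p.21 (after (2.41))] -/
def eps1ThresholdL (d : ℕ) (κ : ℝ) : ℝ :=
  1 / (Real.exp (5 * κ + 1) * K₀ (4 * 2 ^ d) (2 * d) * (2 * (d : ℝ) + 1) * (4 * 2 ^ d))

/-- `ε₁_thr(d, κ) > 0`. [folklore] -/
theorem eps1ThresholdL_pos (d : ℕ) (κ : ℝ) : 0 < eps1ThresholdL d κ := by
  have hK := K₀_pos (4 * 2 ^ d) (2 * d)
  unfold eps1ThresholdL
  positivity

/-- `A₂_thr(d) > 0`. [folklore] -/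
theorem a2ThresholdL_pos (d : ℕ) : 0 < a2ThresholdL d := by
  have hK := K₀_pos (4 * 2 ^ d) (2 * d)
  unfold a2ThresholdL
  positivity

/-- `κ_thr(d, ℓ) ≥ 0`. [folklore] -/
theorem kappaThresholdL_nonneg (d : ℕ) (ℓ : ℝ) : 0 ≤ kappaThresholdL d ℓ :=
  le_max_of_le_right (by have := kappa₀_nonneg (by positivity : (0 : ℝ) ≤ 4 * 2 ^ d) (2 * d); linarith)

/-- Under `(1 − 10δ)ℓ = 1`, `ℓ > 1`: `large ∧ tree ⟺ κ_thr(d, ℓ) ≤ κ` (with `RemainderChainKP.large_iff_of_R22gen`). [cite: Balaban1988RG2Cluster, p.21 (after (2.39)); Balaban1987RG1, (0.25)–(0.26) p.257] -/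
theorem large_and_tree_iff_of_R22gen (c : B13.Consts) {ℓ : ℝ} (h22 : c.R22gen ℓ) (hℓ : 1 < ℓ) :
    (c.κ + 2 * kappa₀ (4 * 2 ^ d) (2 * d) + 2 ≤ (1 - 8 * c.δ) * ℓ * c.κ ∧
        kappa₀ (4 * 2 ^ d) (2 * d) ≤ c.κ / 2) ↔ kappaThresholdL d ℓ ≤ c.κ := by
  rw [RemainderChainKP.large_iff_of_R22gen c h22, kappaThresholdL, max_le_iff,
    div_le_iff₀ (by linarith : (0 : ℝ) < ℓ - 1)]
  constructor
  · rintro ⟨h1, h2⟩; exact ⟨by linarith, by linarith⟩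
  · rintro ⟨h1, h2⟩; exact ⟨by linarith, by linarith⟩

/-- `small ⟺ C₃ε₁ ≤ ε₁_thr(d, κ)`. [folklore] -/
theorem small_iff_eps1ThresholdL (c : B13.Consts) :
    c.C3act * c.ε₁ * Real.exp (5 * c.κ + 1) * K₀ (4 * 2 ^ d) (2 * d) * (2 * (d : ℝ) + 1) * (4 * 2 ^ d) ≤ 1 ↔
      c.C3act * c.ε₁ ≤ eps1ThresholdL d c.κ := by
  have hK := K₀_pos (4 * 2 ^ d) (2 * d)
  have hpos : 0 < Real.exp (5 * c.κ + 1) * K₀ (4 * 2 ^ d) (2 * d) * (2 * (d : ℝ) + 1) * (4 * 2 ^ d) := by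
    positivity
  rw [eps1ThresholdL, le_div_iff₀ hpos]
  constructor <;> intro h <;> nlinarith [h]

/-- **The four numbers ⟺ the three thresholds** (under `(1 − 10δ)ℓ = 1`, `ℓ > 1`). [cite: Balaban1988RG2Cluster, p.21 (after (2.39)–(2.41)); Balaban1987RG1, (0.25)–(0.26) p.257] -/
theorem condsL_iff_thresholds (c : B13.Consts) {ℓ : ℝ} (h22 : c.R22gen ℓ) (hℓ : 1 < ℓ) :
    CondsL d c ℓ ↔ kappaThresholdL d ℓ ≤ c.κ ∧ a2ThresholdL d ≤ c.A₂ ∧ c.C3act * c.ε₁ ≤ eps1ThresholdL d c.κ := by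
  constructor
  · rintro ⟨hl, hs, hA, ht⟩
    exact ⟨(large_and_tree_iff_of_R22gen c h22 hℓ).1 ⟨hl, ht⟩, hA, (small_iff_eps1ThresholdL c).1 hs⟩
  · rintro ⟨hκ, hA, hε⟩
    obtain ⟨hl, ht⟩ := (large_and_tree_iff_of_R22gen c h22 hℓ).2 hκ
    exact ⟨hl, (small_iff_eps1ThresholdL c).2 hε, hA, ht⟩

/-- Joint satisfiability IN PRINTED ORDER: any κ above `κ_thr(d, ℓ)`, any A₂ above `A₂_thr(d)`, and any ε₁ with
`C₃ε₁ ≤ ε₁_thr(d, κ)` AT THAT κ give the four numbers. [folklore] -/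
theorem CondsL.of_thresholds (c : B13.Consts) {ℓ : ℝ} (h22 : c.R22gen ℓ) (hℓ : 1 < ℓ)
    (hκ : kappaThresholdL d ℓ ≤ c.κ) (hA : a2ThresholdL d ≤ c.A₂) (hε : c.C3act * c.ε₁ ≤ eps1ThresholdL d c.κ) :
    CondsL d c ℓ :=
  (condsL_iff_thresholds c h22 hℓ).2 ⟨hκ, hA, hε⟩

/-- At the printed `ℓ = L/2`: `κ_thr(d, L/2) = max{20(κ₀ + 1)/(L − 2), 2κ₀}` — the first entry is the Kotecký–Preiss largeness
`20(κ₀ + 1) ≤ (L − 2)κ`, the second the [I]-side tree-sum restriction `2κ₀ ≤ κ`. [folklore] [cite: Balaban1988RG2Cluster, p.21 (after (2.41): (1 − 10δ)·½L = 1, i.e. ℓ = L/2; cell census R22)] -/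
theorem kappaThresholdL_half (d : ℕ) (L : ℝ) :
    kappaThresholdL d (L / 2) = max (20 * (kappa₀ (4 * 2 ^ d) (2 * d) + 1) / (L - 2)) (2 * kappa₀ (4 * 2 ^ d) (2 * d)) := by
  unfold kappaThresholdL
  have h : L / 2 - 1 = (L - 2) / 2 := by ring
  rw [h, div_div_eq_mul_div]
  ring_nf

/-- For `2 < L ≤ 12` the Kotecký–Preiss largeness ALONE gives the κ-threshold at `ℓ = L/2` (the tree-sum restriction is then
implied: `20(κ₀ + 1)/(L − 2) ≥ 2(κ₀ + 1) > 2κ₀`); for `L > 12` the two entries are independent. [folklore] -/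
theorem kappaThresholdL_half_le_of_KP (c : B13.Consts) {L : ℝ} (hL : 2 < L) (hL12 : L ≤ 12)
    (hKP : 20 * (kappa₀ (4 * 2 ^ d) (2 * d) + 1) ≤ (L - 2) * c.κ) : kappaThresholdL d (L / 2) ≤ c.κ := by
  have hκ₀ := kappa₀_nonneg (by positivity : (0 : ℝ) ≤ 4 * 2 ^ d) (2 * d)
  have hL2 : 0 < L - 2 := by linarith
  rw [kappaThresholdL_half, max_le_iff, div_le_iff₀ hL2]
  refine ⟨by linarith, ?_⟩
  by_contra h
  rw [not_le] at h
  -- κ < 2κ₀ and (L − 2) ≤ 10 contradict 20(κ₀ + 1) ≤ (L − 2)κ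
  nlinarith [hκ₀, h, hL12, hKP, hL2]

/-- d = 4 in numerals: `κ_thr(4, ℓ) = max{10(64 log 162 + 1)/(ℓ − 1), 128 log 162}`. [cite: Balaban1988RG2Cluster, p.21 (after (2.39)); Balaban1987RG1, (0.25)–(0.26) p.257] -/
theorem kappaThresholdL_four (ℓ : ℝ) :
    kappaThresholdL 4 ℓ = max (10 * (64 * Real.log 162 + 1) / (ℓ - 1)) (128 * Real.log 162) := by
  have hκ₀ : kappa₀ (4 * 2 ^ 4) (2 * 4) = 64 * Real.log 162 := kappa₀_four
  unfold kappaThresholdL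
  rw [hκ₀]
  ring_nf

/-- **The (2.38)-grade k-uniform constant from the three thresholds** (`ChainL.abs_beta1_le` ∘ `CondsL.of_thresholds`). [cite: Balaban1988RG2Cluster, Lemma 3 (2.38) p.20 and p.21; Balaban1987RG1, (5.10) p.293, (1.20)–(1.22) p.264] -/
theorem ChainL.abs_beta1_le_of_thresholds {M : ℕ} {μ ν : Fin d} {β : HBeta} {S : B12Beta.OneLoopSplit β} {γ : ℝ}
    {c : B13.Consts} {ℓ α₂ B₃ : ℝ} (R : ChainL d M μ ν S γ c ℓ α₂ B₃) (h22 : c.R22gen ℓ) (hℓ : 1 < ℓ)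
    (hκ : kappaThresholdL d ℓ ≤ c.κ) (hA : a2ThresholdL d ≤ c.A₂) (hε : c.C3act * c.ε₁ ≤ eps1ThresholdL d c.κ)
    (hs : SignsL c α₂ B₃) (hd : 0 < d) (hM : 0 < M) :
    RemainderConst S γ (c.ε₁ * remCoeffL d M c α₂ B₃) :=
  R.abs_beta1_le (CondsL.of_thresholds c h22 hℓ hκ hA hε) h22 hs hd hM

end

end Literature.MathematicalPhysics.QuantumFieldTheory.Balaban1983to89.Beta.RemainderChainLattice
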